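/-
Copyright: statement-level skeleton of a published paper (lit-balaban cell, Phase-2 proof seat p26 gen 35). No claims beyond
what the kernel checks below.
-/
import Mathlib
import Literature.MathematicalPhysics.QuantumFieldTheory.Balaban1983to89.B3Eq332Pictures
import Literature.MathematicalPhysics.QuantumFieldTheory.Balaban1983to89.B3Eq317ZeroTorus

/-!
# B3 — T. Bałaban, *(Higgs)₂,₃ quantum fields in a finite volume. III. Renormalization*, CMP **88** (1983) 411–445
[Balaban1983Higgs3] — p. 437 [PDF 27]: the PICTURE EQUATION **(3.17)** (the graphical summary of the analysis (3.9)–(3.16) of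
the lowest-order scalar self-energy graph with its mass counterterm, (3.8)) AS DRAWN OBJECTS of the concrete graph model
(`B3Cor23Concrete.Graph`, line kinds visible; the pictures-with-localized-legs `B3Eq37Pictures.LocPicture` and the
Hölder-decorated pictures `B3Eq332Pictures.HolderPicture`), together with the local vertex «—•→—» of (3.15) as a drawn DOT,
the COUNT DATA of the three drawn objects DERIVED from the drawings, and the DICTIONARY from the drawn objects to the typed
expressions: (3.11) `B3Ineq313Pointwise.eq311_split`, (3.12) `B3Ineq313Pointwise.term312`, (3.15) `B3Sect3ScalarSelfEnergy.expr315`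
and (3.17) end to end `B3Eq317ZeroTorus.sum_expr39_eq` / `eq317_zero_torus`

statement-level skeleton of published theorems with citation tags; proofs where landed; nothing here is a claim about
the Yang–Mills mass gap

PDF held: `paper:balaban1983-higgs-2-3-quantum-fields-finite-volume` (journal page = PDF page + 410); pp. 417, 423, 434–437
[PDF 7, 13, 24–27] read in the OCR text (`p0025.txt`–`p0027.txt` of `lit read`) and on the ×2 renders
`run/shared/lean/pub/pub-balaban/b2b-balaban-ref1/pages/1983-cmp88-higgs23-III/1983-cmp88-higgs23-III-p025,p026,p027-x2.png` (the
pictures (3.8), (3.12), (3.17) and the dot vertex of (3.15), re-read by this seat 2026-08-23; the text layer garbles every display).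

CITATION HEADER (lean-in-tree rule).  lit-balaban TYPED SKELETON (HOME `run/shared/lean/pub/lit-balaban/`), PHASE 2, seat p26 gen 35
(unit `lit-balaban-p26`; TAKING line HOME/STATUS.md 2026-08-23T02:57:26Z), residual **(c)** *"picture (3.17) at graph level"* of
row **B3.Eq3.11-3.17** of `HOME/lit-balaban-r15/ROWS-B3.md` (fold owner r15, referee ref-4), named by the owner r15 g14
(`B3-CLOSURE.md` v1.21 §5 item 13; OWNER word 2026-08-23T01:58:50Z, verbatim: *"p26's `B3Eq317Pictures` offer — OWNER: YES, that
format meets the Q1 standard (model graphs in p18's vocabulary with line kinds; count data DERIVED from the drawn objects;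
explicit dictionary lemmas to `eq317`/`eq311Z`·`term312Z` + the local vertex; either carrier; stem free"*) — the Q1 standard
being lead g10's head-word criterion of 2026-08-22T21:19:00Z as served by p26 g33's `B3Eq37Pictures`.  CONSUMES BY NAME: p26 g33's
`B3Eq37Pictures` (`LocPicture`, `kind36`, `sLeg`, `vLeg`, `other36`, `pic36a`, `pic37a`, `pic38`, `PictureDiff`, `loc37`, `legDiffs`,
`legDiffs36`, `countsOf`, `enum36a`, `countsOf_g36a`, `LocPicture.amp`, `kernel2`, `amp_pic38`, `expr39_eq_neg_amp_pic38`), p37 g90's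
`B3Eq332Pictures.HolderPicture` (+ `HolderPicture.deg`), p18 gen 3's drawn graph (3.6)₁ `B3Sect3LowestOrderGraphs.g36a`
(`g36a_deg`) on the model `B3Cor23Concrete.Graph`, r15's vertex counts `B3Sect2Statements.VertexCounts`/`degree`/`counts17`
(`degree_v17`) and `B3VertexBridge.toCounts`, this lineage's member data `B3Eq312Member.graph38`/`κ312`/`memberK312`
(`degQK_two_graph38_shift`, `degQK_block_pos_graph38`, `posSubgraphsExcept24_memberK312`), r15's (3.9)/(3.11)/(3.15) carrier
`B3Sect3ScalarSelfEnergy` (`coeff39`, `expr39`, `bracket315`, `expr315`, `expr315_eq`) and kernel `B3Eq330Members.sigma39`, p20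
g2's (3.10)/(3.12) `B3Taylor310Remainder.disp`/`remFwd`/`steps`/`HolderDeriv` and `B3Ineq313Pointwise.term312`/`eq311_split`, p20
g6's (3.17) assembly `B3Eq317ZeroTorus.sum_expr39_eq`/`eq317_zero_torus` (with p20 g5's pieces `B3Sect3KernelsZeroTorus.gpiece`).

THE PRINTED TEXT (verbatim).  p. 437 [PDF 27]: *"Let us consider the first expression on the right side of (3.11). The same
expression appears for all orderings of the lines of the graph G₀ with the only condition that they are earlier than the external
lines. Making summations over these orderings and indices means that we sum with respect to j, j′ from 0 to j″, where j″ is the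
lowest index of the external lines. After the summations we get
− Σ_{μ=1}^d Σ_x η^dφ(x)·[Σ_{x′}η^d Σ_{ν=1}^d q(∂^η_νG^η_{j″}(0)∂^{η*}_ν)(x,x′)qg(x)G^η_{j″}(x,x′)g′(x′)(x′_μ − x_μ)](∂^η_μφ′)(x), (3.15)
and this expression is represented graphically by —•→—. Let us estimate the coefficient in the vertex, i.e. the expression in
the square brackets in (3.15). … and the corresponding inequalities for derivatives, we can estimate (3.16) by a constant. Thus we
have finished the analysis of (3.8) and we can summarize it in the following graphical form
[——○→—◄○—— with the wavy line joining the two vertices] − [the vertex x carrying both external legs, the wavy line and the arrowed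
line running to x′] = [—•→—] + [——○→—◄○→——, the blob inscribed +(1+α), the second external leg carrying the arrowhead −(1+α)] (3.17)
It is of the required form (3.5)."*; p. 436 [PDF 26] on the last picture: *"The second expression above already has the right form
because the factor |x − x|^{1+α}"* ⟦sic; `|x′ − x|` is meant, cf. (3.10)/(3.11)⟧ *"adds to the degree of the graph the number 1 + α,
thus the degree of the expression is equal to −d + 3 + α now. The operator acting on the leg φ′ is a differentiation of the order
1 + α, so we will represent graphically this expression by the generalized graph [picture] (3.12)"*; p. 434 [PDF 24] on the form
(3.5): *"Σ_{G∈G_ren}Σ_{l̃}Σ_{j∈J(l̃)} E(G(j),…) = Σ_{G′∈G′_fin}Σ_{l̃′}Σ_{j∈J(l̃′)} γ(G′,l̃′)E′(G′(j),…), (3.5) where E′(G′,…) is a generalized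
expression corresponding to the graph G′ … a sequence of subgraphs G′₁, …, G′_m = G′ … consists of subgraphs with positive degrees
D(G′_i) > 0"*; p. 428 [PDF 18] (before Proposition 2.2): generalized graphs have *"vertices with an arbitrary number of legs and
arbitrary power of η"*; p. 423 [PDF 13]: *"Also we define a degree D(v) of a vertex v in the same way as above assuming that G
contains all the elements of the vertex v."*; p. 417 [PDF 7]: *"δm²_G … will be represented by the same graph G but with both
external legs localized in x and with the summation over x′."*; p. 415 legend (1.17): straight line = φ′, wavy line = A′,
arrowhead = differentiation.
READING OF THE PICTURES (p. 437 render).  LHS of (3.17) = the formal difference (3.8) = [(3.6)₁] − [(3.7)₁'s picture] — p26 g33's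
`B3Eq37Pictures.pic38` (the drawn graph `g36a`: vertices x, x′ of the kind (1.8)_{1,0}, the φ′-line through both arrowed legs, the
A′-line; natural localization, resp. both external legs at x).  RHS₂ = the generalized graph (3.12): THE SAME drawn graph with its
natural localization (external legs at both ends, as drawn), the blob inscribed "+(1+α)" (the weight |x′ − x|^{1+α}) and the
external φ′-leg of x′ carrying the arrowhead "−(1+α)" (the remainder of Taylor's formula (3.10) of the leg φ′ around x, *"a
differentiation of the order 1 + α"*) — p37 g90's `HolderPicture` with exponent `1 + α`, decorated leg `sLeg 1 1`, base `x = 0`.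
RHS₁ = «—•→—»: a DOT (no internal line) with two external φ′-legs AT THE SAME POINT x, the leg of φ plain and the leg of φ′ with
ONE arrowhead (the lattice derivative ∂^η_μ), whose coefficient is the square bracket of (3.15) — a local generalized VERTEX in
the sense of (3.5)/p. 428, not a graph of p. 415 (*"There is at least one internal line"*; p18's `Graph.exists_line`), whence the
small structure `DotPicture` below.

WHAT IS TYPED / PROVED (definitions with bodies + theorems; no `Prop` fact, no `sorry`; standard axioms).
§1 DRAWN OBJECTS.  **`dec312 α`** = (3.12) as a `HolderPicture` on `pic36a` (`dec312_data`, `dec312_G`: the same drawn graph as the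
LHS, `dec312_loc`: φ at x, the decorated φ′-leg at x′, `dec312_wleg`: the decorated leg is the external UNDIFFERENTIATED φ′-leg of
x′); **`DotPicture`** (a local vertex drawn as a dot: numbers of scalar/vector legs and the arrowheads on each, no line — generic,
so that the (3.30)/(3.32) vertices ∿∗→∿, ∿∗∿, ∿×∿ are instances) and **`dot315`** = ⟨2 scalar legs, arrows (0, 1), no vector leg⟩;
**`PicEq317`/`pic317`** = (3.17) as the triple (LHS : `PictureDiff`, RHS₁ : `DotPicture`, RHS₂ : `HolderPicture`) (`pic317_terms`);
the legs of the dot DERIVED from the drawn (3.8): `dot315_legs_derived` (its two scalar legs = the two EXTERNAL legs of (3.6)₁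
brought to one point — p18's `numExtLegs` = 2, `numExtLegs_g36a`; the φ-leg as plain as in the graph, the φ′-leg with its own `0` arrows PLUS ONE = one order
of the Taylor expansion (3.10)).
§2 COUNT DATA.  **`deg_dec312 : (dec312 α).deg d = −d + 3 + α`** (print's number: p37's rule D(G) + exponent with p18's `g36a_deg`),
`deg_dec312_three` (= α at d = 3), **`label_dec312`** (the printed leg label "−(1+α)" DERIVED by p37's rule: differentiations
already on the leg + blob exponent = 0 + (1+α)); the link to this lineage's Proposition-2.2 member of (3.12): at the sample value
α = ½ (p. 421 *"e.g. if we take α₀ = ½"*) `exponent_dec312_half` (the blob exponent 3/2 IS `B3Eq312Member.κ312 0`, the extra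
dimension booked on the φ′-line of `memberK312`) and **`deg_dec312_half_eq_degQK`** (the decorated picture's degree ½ IS the
generalized degree D_K(G′) of the count datum DERIVED from the drawing, `countsOf_g36a` + `degQK_two_graph38_shift` = `degQK_two_countsOf_g36a`, along
either ordering), `blocks_pos_dec312` (every non-trivial block of that derived datum has positive generalized degree — the (3.5)
property *"subgraphs with positive degrees"* of RHS₂; `degQK_block_pos_graph38` transported; the family-level statement is
`posSubgraphsExcept24_memberK312`, cited).  For the dot: **`DotPicture.counts d : VertexCounts`** (η^d of the one vertex sum, the
legs, the arrowheads as differentiations, not an averaging vertex), **`dot315_counts`** (= ⟨d, 2, 0, 1, false⟩),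
**`dot315_counts_eq_v17`** (= r15's datum of the mass-counterterm vertex (1.7) `toCounts d .v17` WITH ONE DIFFERENTIATION — (3.15) is a
two-φ′-leg local vertex like (1.7) −½Ση^dδm²|φ′|², with ∂^η_μ on one leg), **`degree_dot315 : degree d (dot315.counts d) = 1`** (p. 423's
D(v) of the generalized vertex, one less than `degree_v17 = 2`: `degree_dot315_eq_v17_sub_one`).
§3 DICTIONARY (torus carrier `Site P j`, the carrier of `LocPicture.amp`).  **`amp315 η c φ φ′`** := Σ_μΣ_xη^d⟪φ(x), c_μ(x)(∂^η_μφ′)(x)⟫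
(the expression of the dot: both legs at x, the arrow = ∂^η_μ, coefficient c); **`vertexCoeff315 η Σ μ x`** := Σ_{x′}η^d(x′_μ − x_μ)Σ(x,x′)
(*"the coefficient in the vertex"*) with **`vertexCoeff315_sigma39`**: for the kernel Σ₃₉ read off the lines of (3.6)₁ it IS r15's
square bracket `bracket315 … • q²`, and **`amp315_sigma39 : amp315 η (vertexCoeff315 η Σ₃₉[G₀,G]) φ φ′ = −expr315 η q G₀ G …`** (r15's
(3.15) carries print's exterior "−"); **`ampT1`** (the FIRST-ORDER TAYLOR reading of a localized picture: the moved leg's field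
replaced by Σ_μ(x′_μ − x_μ)(∂^η_μφ′)(x), x = its localization vertex, x′ = its own vertex; `ampT1_natural` = 0) with the COLLAPSE
lemma **`ampT1_pic37a_eq_amp315`**: the p. 417-localized (3.6)₁ with the first-order decoration IS the dot with the coefficient
`vertexCoeff315` (*"this expression is represented graphically by —•→—"*); **`ampR`** (the expression of a scalar Hölder-decorated
picture: the decorated leg reads as p20's (3.10) remainder `remFwd η⁻¹ φ′ x_base x_leg`; the insert-and-divide by |x′−x|^{1+α} of
print is not performed, as in r15's `eq311` T3 — the exponent is the drawn label, its analytic content is p20's `norm_remFwd_le`)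
with **`ampR_dec312 : ampR (dec312 α) … (kernel2 Σ₃₉) φ φ′ = term312 η q G_j G_j′ g g′ φ φ′`** (p20's (3.12));
**`eq317_pair`** (η ≠ 0, every α, per pair of line propagators): amp(pic38)[Σ₃₉(G_j,G_j′)] = amp315[vertexCoeff315 Σ₃₉(G_j,G_j′)] +
ampR(dec312)[G_j,G_j′] — (3.11) `eq311_split` through `expr39_eq_neg_amp_pic38`; **`eq317`** — (3.17) AS PRINTED, after *"Making
summations over these orderings and indices"*: for families `G0fam`, `Gfam` of line propagators, Σ_{i,i′<k} amp(pic38)[Σ₃₉(G0fam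
i, Gfam i′)] = amp315[vertexCoeff315 Σ₃₉(Σ_iG0fam i, Σ_{i′}Gfam i′)] + Σ_{i,i′<k} ampR(dec312)[i,i′] — p20's `sum_expr39_eq` BY NAME.
§4 **`eq317_pic_zeroTorus`** — (3.17) *"of the required form (3.5)"* at the hypothesis-free zero-field torus instance, d = 3 (p20 g6's
`eq317_zero_torus` through the dictionary): for the pieces `gpiece` of the tower's propagator, (a) the picture identity, (b) the dot
has a BOUNDED coefficient, |amp315| ≤ Cst·Σ_μΣ_xη³‖φ(x)‖‖q²(∂^η_μφ′)(x)‖, (c) every decorated piece obeys the generalized-graph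
estimate (3.13) (degree −d + 3 + α).
HONEST SCOPE.  (i) As in `B3Eq37Pictures`/`B3Eq332Pictures`: localization, decoration and the dot are this file's READING of pp.
417/436/437 on top of p18's model, which has no amplitude map of its own; the kernel (here Σ₃₉ = `sigma39`, the printed propagators of
the two lines and the printed vertex factors) is supplied by the caller — a dictionary for the pictures of Sect. 3, not a
Feynman-rule evaluator.  (ii) The dot «—•→—» is typed by the NEW structure `DotPicture` because a line-less vertex is neither a
`B3Cor23Concrete.Graph` (≥ 1 internal line) nor a p19 `Counts` datum (every vertex on a line); its count datum is r15's
`VertexCounts` of a generalized vertex (p. 428); the boundedness of its coefficient ((3.16), *"by a constant"*) is an ESTIMATE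
(§4 (b), p20/p39's files), not part of the datum; its η-power `d` is the one explicit lattice sum of (3.15).  (iii) `ampR` does not
depend on the exponent field (the drawn label 1+α records the ORDER of the remainder; T3 of r15's `eq311`).  (iv) d = 3, L = 2,
δ₁ = 1, α = ½ in the member-level links (`B3Eq312Member`'s constants); `deg_dec312` itself is for every d and α.  (v) The
dictionary is on the torus carrier `Site P j` of `LocPicture.amp`; the ηℤ³ twin of (3.17) is p39 g17's `B3Eq317ZeroLattice.
eq317_zeroLattice` / `B3GscaleLatRescaling.eq317_zeroLattice_allScales` over p26 g34's `eq311Z`/`term312Z` (cited, not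
re-dictionaried).  (vi) Nothing analytic is added: (3.11), (3.13)–(3.16) and the resummation are the cited files' theorems.
Unit `lit-balaban-p26` gen 35 (literature-prover-lit-balaban-p26-g35-0), HOME `run/shared/lean/pub/lit-balaban/`, 2026-08-23.
v1.1 (p26 gen 35, 2026-08-23; DOC-ONLY, declarations byte-identical): the fold owner r15 g14's wish of 2026-08-23T03:17:28Z — a pointer to
the LATTICE form of (3.17) (p39 g17's `B3Eq317ZeroLattice.eq317_zeroLattice`, p348524, and `B3GscaleLatRescaling.eq317_zeroLattice_allScales`,
p349406, over p26 g34's `eq311Z`/`term312Z`/`eq315Z_zeroLattice`) placed next to `eq317` and `eq317_pic_zeroTorus`.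
-/

open Finset

namespace Literature.MathematicalPhysics.QuantumFieldTheory.Balaban1983to89.B3Eq317Pictures

/-! ## §1 The drawn objects of (3.17): the difference (3.8), the dot «—•→—», the generalized graph (3.12) -/

section Pictures

open B3Prop1 B3Cor23Concrete B3Sect3LowestOrderGraphs B3Eq37Pictures B3Eq332Pictures

variable {nbar : ℕ} (hn : 1 ≤ nbar)

/-- **RHS₂ of (3.17) = the generalized graph (3.12)** p. 436 [PDF 26]: the drawn graph (3.6)₁ (p18's `g36a`) with its natural
localization (the leg of φ at x = `0`, the leg of φ′ at x′ = `1`, as drawn), the blob inscribed "+(1+α)" (the weight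
|x′ − x|^{1+α}) and the external φ′-leg of x′ (`sLeg 1 1`) carrying the arrowhead "−(1+α)" relative to the vertex x (the
remainder of (3.10), *"a differentiation of the order 1 + α"*) — p37's `HolderPicture` with exponent `1 + α`.
[cite: Balaban1983Higgs3, (3.12) p.436] -/
def dec312 (hn : 1 ≤ nbar) (α : ℝ) : HolderPicture nbar where
  toLocPicture := pic36a hn
  α := 1 + α
  wleg := sLeg 1 1
  base := (0 : Fin 2)
  wleg_ext := g36a_other_sLeg1 hn 1

/-- **A LOCAL VERTEX DRAWN AS A DOT** (the picture «—•→—» of (3.15)/(3.17); also the vertices ∿∗→∿, ∿∗∿ of (3.30) and ∿×∿ of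
(3.32)): a generalized vertex of (3.5) — p. 428 *"vertices with an arbitrary number of legs and arbitrary power of η"* — with
`nS` external scalar (φ′, straight) legs and `nV` external vector (A′, wavy) legs at ONE point, each leg carrying a number of
arrowheads (lattice differentiations, legend (1.17)), and NO internal line (so it is not a graph of p. 415, which has *"at
least one internal line"*); its coefficient is a function of the point (for (3.15): the square bracket).
[cite: Balaban1983Higgs3, (3.15) p.437] -/
structure DotPicture where
  /-- number of scalar legs (straight) -/
  nS : ℕ
  /-- number of vector legs (wavy) -/
  nV : ℕ
  /-- arrowheads carried by each scalar leg -/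
  arrowS : Fin nS → ℕ
  /-- arrowheads carried by each vector leg -/
  arrowV : Fin nV → ℕ

/-- **RHS₁ of (3.17), the dot «—•→—» of (3.15)** p. 437 [PDF 27]: two scalar legs at the point x — the leg `0` of φ (plain) and
the leg `1` of φ′ with ONE arrowhead (the derivative ∂^η_μ of (∂^η_μφ′)(x)) — no vector leg, no line.
[cite: Balaban1983Higgs3, (3.15) p.437] -/
def dot315 : DotPicture := ⟨2, 0, ![0, 1], ![]⟩

/-- A picture equation [difference of two pictures] = [dot] + [decorated picture], as printed in (3.17) (the model has no
algebra of pictures; the three drawn objects are recorded in order). [cite: Balaban1983Higgs3, (3.17) p.437] -/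
structure PicEq317 (nbar : ℕ) where
  /-- the left side: (3.8) = [(3.6)₁] − [(3.7)₁'s picture] -/
  lhs : PictureDiff nbar
  /-- the first term of the right side: the local vertex «—•→—» -/
  dot : DotPicture
  /-- the second term of the right side: the generalized graph (3.12) -/
  dec : HolderPicture nbar

/-- **(3.17)** p. 437 [PDF 27]: [(3.6)₁ − (3.7)₁] = [—•→—] + [(3.12)], for the Hölder exponent `α` of the leg.
[cite: Balaban1983Higgs3, (3.17) p.437] -/
def pic317 (hn : 1 ≤ nbar) (α : ℝ) : PicEq317 nbar := ⟨pic38 hn, dot315, dec312 hn α⟩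

/-- (3.17) = (LHS, RHS₁, RHS₂) = (p26 g33's `pic38`, the dot, the decorated (3.6)₁). [cite: Balaban1983Higgs3, (3.17) p.437] -/
theorem pic317_terms (α : ℝ) :
    (pic317 hn α).lhs = pic38 hn ∧ (pic317 hn α).dot = dot315 ∧ (pic317 hn α).dec = dec312 hn α := ⟨rfl, rfl, rfl⟩

/-- The data of (3.12): the drawn graph and localization of (3.6)₁, exponent `1 + α`, decorated leg = the external φ′-leg of x′,
base vertex x. [cite: Balaban1983Higgs3, (3.12) p.436] -/
theorem dec312_data (α : ℝ) :
    (dec312 hn α).toLocPicture = pic36a hn ∧ (dec312 hn α).α = 1 + α ∧ (dec312 hn α).wleg = sLeg 1 1 ∧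
      (dec312 hn α).base = (0 : Fin 2) := ⟨rfl, rfl, rfl, rfl⟩

/-- (3.12) has THE SAME drawn graph as both pictures of the left side of (3.17) (p18's `g36a`). [cite: Balaban1983Higgs3, (3.17) p.437] -/
theorem dec312_G (α : ℝ) :
    (dec312 hn α).G = (pic38 hn).pos.G ∧ (dec312 hn α).G = (pic38 hn).neg.G ∧ (dec312 hn α).G = g36a nbar hn :=
  ⟨rfl, rfl, rfl⟩

/-- As drawn in (3.12)/(3.17): the leg of φ sits at x = `0`, the decorated leg of φ′ at x′ = `1` (external legs at both ends —
the natural localization, unlike the counterterm picture (3.7)₁). [cite: Balaban1983Higgs3, (3.12) p.436] -/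
theorem dec312_loc (α : ℝ) :
    (dec312 hn α).loc (sLeg 0 1) = (0 : Fin 2) ∧ (dec312 hn α).loc (sLeg 1 1) = (1 : Fin 2) := ⟨rfl, rfl⟩

/-- The decorated leg of (3.12) is an EXTERNAL leg of the drawn graph and carries NO differentiation of its vertex (it is the
undifferentiated φ′-leg of x′; the arrowhead "−(1+α)" is the decoration). [cite: Balaban1983Higgs3, (3.12) p.436] -/
theorem dec312_wleg (α : ℝ) :
    (g36a nbar hn).other (dec312 hn α).wleg = none ∧ legDiffs (g36a nbar hn) (dec312 hn α).wleg = 0 := by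
  refine ⟨g36a_other_sLeg1 hn 1, ?_⟩
  show legDiffs (g36a nbar hn) (sLeg 1 1) = 0
  rw [(legDiffs_g36a hn _).1]
  decide

/-- The dot of (3.15): two scalar legs, no vector leg, the arrow on the leg of φ′ only. [cite: Balaban1983Higgs3, (3.15) p.437] -/
theorem dot315_legs :
    dot315.nS = 2 ∧ dot315.nV = 0 ∧ dot315.arrowS (0 : Fin 2) = 0 ∧ dot315.arrowS (1 : Fin 2) = 1 :=
  ⟨rfl, rfl, rfl, rfl⟩

/-- **The drawn graph (3.6)₁/(3.8) has exactly TWO external legs** (p18's vertex-by-vertex count `numExtLegs`; they are the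
undifferentiated φ′-legs of x and of x′, p26 g33's `g36a_other_eq_none_iff`). [cite: Balaban1983Higgs3, (3.8) p.435] -/
theorem numExtLegs_g36a : (g36a nbar hn).numExtLegs = 2 := by
  rfl

/-- **The legs of the dot DERIVED from the drawn (3.8)**: its scalar legs are the EXTERNAL legs of (3.6)₁ brought to the one
point x (two of them, no vector leg); the leg of φ carries as many arrows as in the graph (`legDiffs (g36a) (sLeg 0 1) = 0`), the
leg of φ′ its own `legDiffs (g36a) (sLeg 1 1) = 0` arrows PLUS ONE — one order of the Taylor expansion (3.10) of φ′ around x, the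
arrowhead ∂^η_μ of (3.15). [cite: Balaban1983Higgs3, (3.15) p.437] -/
theorem dot315_legs_derived :
    dot315.nS = (g36a nbar hn).numExtLegs ∧ dot315.nV = 0 ∧
      dot315.arrowS (0 : Fin 2) = legDiffs (g36a nbar hn) (sLeg 0 1) ∧
        dot315.arrowS (1 : Fin 2) = legDiffs (g36a nbar hn) (sLeg 1 1) + 1 := by
  refine ⟨by rw [numExtLegs_g36a hn]; rfl, rfl, ?_, ?_⟩
  · rw [(legDiffs_g36a hn _).1]; decide
  · rw [(legDiffs_g36a hn _).1]; decide

end Pictures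

/-! ## §2 Count data: "−d + 3 + α", the member (3.12), and the vertex counts of the dot -/

section Counting

open B3Prop1 B3Cor23Concrete B3Sect3LowestOrderGraphs B3Eq37Pictures B3Eq332Pictures
open B3Sect2Statements B3VertexBridge B3Ineq215 B3Ineq213 B3FreeLine B3TwoVertexBlocks B3Eq312Member

variable {nbar : ℕ} (hn : 1 ≤ nbar)

noncomputable section

/-- **p. 436: "the factor |x − x|^{1+α}"** ⟦sic; `|x′ − x|`⟧ **"adds to the degree of the graph the number 1 + α, thus the degree of
the expression is equal to −d + 3 + α now"** — for the drawn object: D(G) + exponent = (2 − d) + (1 + α) (p37's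
`HolderPicture.deg`, p18's `g36a_deg`). [cite: Balaban1983Higgs3, (3.12) p.436] -/
theorem deg_dec312 (d : ℕ) (α : ℝ) : (dec312 hn α).deg d = -(d : ℝ) + 3 + α := by
  show ((g36a nbar hn).deg d : ℝ) + (1 + α) = _
  rw [g36a_deg]
  push_cast
  ring

/-- At d = 3 the decorated picture (3.12) has degree α (> 0 for α > 0: *"already has the right form"*).
[cite: Balaban1983Higgs3, (3.12) p.436] -/
theorem deg_dec312_three (α : ℝ) : (dec312 hn α).deg 3 = α ∧ (0 < (dec312 hn α).deg 3 ↔ 0 < α) := by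
  have h : (dec312 hn α).deg 3 = α := by rw [deg_dec312]; norm_num
  exact ⟨h, by rw [h]⟩

/-- **The printed leg label "−(1+α)" DERIVED** (p37's rule for decorated legs: the differentiations the leg already carries in
its vertex plus the blob exponent): `0 + (1 + α)` — *"The operator acting on the leg φ′ is a differentiation of the order 1 + α"*.
[cite: Balaban1983Higgs3, (3.12) p.436] -/
theorem label_dec312 (α : ℝ) : (legDiffs (g36a nbar hn) (dec312 hn α).wleg : ℝ) + (dec312 hn α).α = 1 + α := by
  rw [(dec312_wleg hn α).2]
  show ((0 : ℕ) : ℝ) + (1 + α) = 1 + α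
  push_cast
  ring

/-- At the sample value α = ½ of p. 421 (*"e.g. if we take α₀ = ½"*) the blob exponent `1 + α = 3/2` of (3.12) IS the extra line
dimension `κ312 0` that this lineage's Proposition-2.2 member `memberK312` books on the φ′-line of the count datum `graph38`.
[cite: Balaban1983Higgs3, (3.12) p.436] -/
theorem exponent_dec312_half : (dec312 hn (1 / 2)).α = ((κ312 0 : ℚ) : ℝ) := by
  show (1 + 1 / 2 : ℝ) = ((κ312 0 : ℚ) : ℝ)
  simp only [κ312]
  norm_num

/-- The generalized degree D_K(G′) of the count datum DERIVED from the drawing of (3.6)₁ (p26 g33's `countsOf_g36a` = `graph38`)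
with the extra dimensions `κ312`, along either ordering `σ` of the two lines: `−1 + 3/2 = ½` (`B3Eq312Member.degQK_two_graph38_shift`
transported). [cite: Balaban1983Higgs3, (3.12) p.436] -/
theorem degQK_two_countsOf_g36a (σ : Equiv.Perm (Fin 2)) :
    degQK (relabelCounts (countsOf (g36a nbar hn) (enum36a hn) 3 2 1 (by norm_num) le_rfl one_pos) σ) (κ312 ∘ σ) 2
      (0 : Fin 2) = 1 / 2 := by
  rw [countsOf_g36a]
  exact degQK_two_graph38_shift σ

/-- **The degree of the drawn decorated picture IS the generalized degree of the count datum DERIVED from the drawing**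
(α = ½, d = 3): `(dec312 ½).deg 3 = ½ = D_K(G′)` of `countsOf (g36a) (enum36a)` with the extra dimensions `κ312`, along either
ordering of the two lines. [cite: Balaban1983Higgs3, (3.12) p.436] -/
theorem deg_dec312_half_eq_degQK (σ : Equiv.Perm (Fin 2)) :
    (dec312 hn (1 / 2)).deg 3 =
      ((degQK (relabelCounts (countsOf (g36a nbar hn) (enum36a hn) 3 2 1 (by norm_num) le_rfl one_pos) σ) (κ312 ∘ σ) 2
        (0 : Fin 2) : ℚ) : ℝ) := by
  rw [(deg_dec312_three hn (1 / 2)).1, degQK_two_countsOf_g36a hn σ]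
  norm_num

/-- **(3.5) for RHS₂ — "subgraphs with positive degrees"**: every non-trivial block of the datum derived from the drawing of (3.12),
along every ordering of its two lines, has POSITIVE generalized degree (`3/2`, `2` or `½`; `B3Eq312Member.degQK_block_pos_graph38`
transported along `countsOf_g36a`; at family level: `posSubgraphsExcept24_memberK312`). [cite: Balaban1983Higgs3, (3.5) p.434] -/
theorem blocks_pos_dec312 {σ : Equiv.Perm (Fin 2)} {i : Fin 3} {b : Fin 2}
    (hb : b ∈ (relabelCounts (countsOf (g36a nbar hn) (enum36a hn) 3 2 1 (by norm_num) le_rfl one_pos) σ).toModel.reps (i : ℕ))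
    (hnt : (relabelCounts (countsOf (g36a nbar hn) (enum36a hn) 3 2 1 (by norm_num) le_rfl one_pos) σ).toModel.Nontriv (i : ℕ) b) :
    0 < degQK (relabelCounts (countsOf (g36a nbar hn) (enum36a hn) 3 2 1 (by norm_num) le_rfl one_pos) σ) (κ312 ∘ σ) i b := by
  rw [countsOf_g36a] at hb hnt ⊢
  exact degQK_block_pos_graph38 hb hnt

/-! ### The vertex counts of the dot -/

/-- **The count datum of a dot** as a generalized vertex (r15's `VertexCounts`, the data (2.1) consumes): the η-power of its one
lattice sum `Σ_x η^d`, its scalar and vector legs, its arrowheads as differentiations; not an averaging vertex (1.14)/(1.15).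
[cite: Balaban1983Higgs3, (2.1) p.422] -/
def DotPicture.counts (D : DotPicture) (d : ℕ) : VertexCounts :=
  ⟨d, D.nS, D.nV, (∑ i, D.arrowS i) + ∑ i, D.arrowV i, false⟩

/-- The counts of «—•→—»: η^d, two scalar legs, no vector leg, ONE differentiation. [cite: Balaban1983Higgs3, (3.15) p.437] -/
theorem dot315_counts (d : ℕ) : dot315.counts d = ⟨d, 2, 0, 1, false⟩ := by
  show (⟨(d : ℤ), 2, 0, (∑ i : Fin 2, (![0, 1] : Fin 2 → ℕ) i) + ∑ i : Fin 0, (![] : Fin 0 → ℕ) i, false⟩ : VertexCounts) = _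
  simp [Fin.sum_univ_two]

/-- **«—•→—» is the mass-counterterm vertex (1.7) with one differentiation**: its counts are r15's datum `toCounts d .v17` of
(1.7) = −½Σ_xη^dδm²(L^kε)²|φ′(x)|² (η^d, two φ′-legs) with `diffs := 1` (the arrow ∂^η_μ on the leg of φ′).
[cite: Balaban1983Higgs3, (1.7) p.413, (3.15) p.437] -/
theorem dot315_counts_eq_v17 (d : ℕ) : dot315.counts d = { toCounts d .v17 with diffs := 1 } := by
  rw [dot315_counts]
  rfl

/-- **D(v) of the dot** (p. 423: *"a degree D(v) of a vertex v … assuming that G contains all the elements of the vertex v"*, r15's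
`degree`): `d + 2·(2 − d)/2 − 1 = 1` in every dimension. [cite: Balaban1983Higgs3, (2.1) p.422] -/
theorem degree_dot315 (d : ℕ) : degree d (dot315.counts d) = 1 := by
  rw [dot315_counts]
  simp [degree, degreeIn, Incidence.full]
  ring

/-- … one less than the degree `2` of the mass-counterterm vertex (1.7) (r15's `degree_v17`): the arrow costs `1`.
[cite: Balaban1983Higgs3, (2.1) p.422] -/
theorem degree_dot315_eq_v17_sub_one (d : ℕ) : degree d (dot315.counts d) = degree d (counts17 d) - 1 := by
  rw [degree_dot315, degree_v17]
  norm_num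

end

end Counting

/-! ## §3 The dictionary: the three pictures of (3.17) ↦ (3.15), (3.12), and (3.17) = (3.11) summed -/

section Dictionary

open B3Prop1 B3Cor23Concrete B3Sect3LowestOrderGraphs B3Eq37Pictures B3Eq332Pictures
open LatticeFieldCalculus (pdiff)
open B3Sect3ScalarSelfEnergy B3Sect3Subtraction319 B3Eq330Members
open B3Taylor310Remainder (disp remFwd steps)
open B3Ineq313Pointwise (term312 eq311_split)
open B3Eq317ZeroTorus (sum_expr39_eq)

open scoped RealInnerProductSpace

noncomputable section

variable {nbar : ℕ} {P : Params} {j : ℕ} {W : Type*} [NormedAddCommGroup W] [InnerProductSpace ℝ W]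

/-- **The expression of the dot «—•→—»** with a coefficient `c_μ(x) : W →ₗ W`: both legs at the point x, the leg of φ plain,
the leg of φ′ under its arrow ∂^η_μ, summed over the direction of the arrow and the point — `Σ_μ Σ_x η^d ⟪φ(x), c_μ(x)
(∂^η_μφ′)(x)⟫` (the shape of (3.15) without its exterior sign). [cite: Balaban1983Higgs3, (3.15) p.437] -/
def amp315 (η : ℝ) (c : Fin P.d → Site P j → W →ₗ[ℝ] W) (φ φ' : SiteField P j W) : ℝ :=
  ∑ μ : Fin P.d, ∑ x : Site P j, η ^ P.d * ⟪φ x, c μ x (pdiff η⁻¹ μ φ' x)⟫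

/-- **"the coefficient in the vertex"** of «—•→—» produced by a two-point kernel `Σ(x,x′)` of the collapsed graph:
`c_μ(x) = Σ_{x′} η^d (x′_μ − x_μ) Σ(x,x′)` (the displacement `disp η⁻¹ x x′ μ = x′_μ − x_μ` of (3.10)/(3.11), p20's reading along
Γ_{x,x′}). [cite: Balaban1983Higgs3, (3.15) p.437] -/
def vertexCoeff315 (η : ℝ) (Sg : Site P j → Site P j → W →ₗ[ℝ] W) (μ : Fin P.d) (x : Site P j) : W →ₗ[ℝ] W :=
  ∑ x' : Site P j, (η ^ P.d * disp η⁻¹ x x' μ) • Sg x x'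

/-- **The FIRST-ORDER TAYLOR reading of a localized picture** with two chosen external φ′-legs `e`, `e′`: as `LocPicture.amp`, but
the field of the leg `e′` — moved from its own vertex x′ = `xs e′.1` to its localization vertex x = `xs (loc e′)` — replaced by
the first-order term of (3.10), `Σ_μ (x′_μ − x_μ)(∂^η_μφ′)(x)`. [cite: Balaban1983Higgs3, (3.10) p.435, (3.11) p.436] -/
def ampT1 (Pic : LocPicture nbar) (e e' : Leg Pic.G.kind) (η : ℝ) (K : (Fin Pic.G.nV → Site P j) → W →ₗ[ℝ] W)
    (φ φ' : SiteField P j W) : ℝ :=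
  ∑ xs : Fin Pic.G.nV → Site P j, η ^ (Pic.G.nV * P.d) *
    ∑ μ : Fin P.d, disp η⁻¹ (xs (Pic.loc e')) (xs e'.1) μ * ⟪φ (xs (Pic.loc e)), K xs (pdiff η⁻¹ μ φ' (xs (Pic.loc e')))⟫

/-- **The expression of a scalar Hölder-DECORATED picture** with the undecorated external φ′-leg `e` (field φ): as
`LocPicture.amp`, the decorated leg reading as the REMAINDER of Taylor's formula (3.10) of its field φ′ between the base vertex
`xs base` and its localization vertex `xs (loc wleg)` (p20's `remFwd`, the remainder in the forward-derivative reading used by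
`eq311`; print's *"differentiation of the order 1 + α"* — the factor |x′−x|^{1+α} inserted and divided in print is not performed,
so the exponent field is the drawn label only). [cite: Balaban1983Higgs3, (3.11) p.436] -/
def ampR (H : HolderPicture nbar) (e : Leg H.G.kind) (η : ℝ) (K : (Fin H.G.nV → Site P j) → W →ₗ[ℝ] W)
    (φ φ' : SiteField P j W) : ℝ :=
  ∑ xs : Fin H.G.nV → Site P j, η ^ (H.G.nV * P.d) *
    ⟪φ (xs (H.loc e)), K xs (remFwd η⁻¹ φ' (xs H.base) (xs (H.loc H.wleg)))⟫

/-- kernel: a sum over the positions of two vertices is a double sum. [folklore] -/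
private theorem sum_arrow_fin_two {α M : Type*} [Fintype α] [AddCommMonoid M] (f : (Fin 2 → α) → M) :
    ∑ xs : Fin 2 → α, f xs = ∑ a : α, ∑ b : α, f ![a, b] := by
  rw [← (finTwoArrowEquiv α).symm.sum_comp f, Fintype.sum_prod_type]
  rfl

/-- kernel: the displacement of (3.10) from a point to itself vanishes. [folklore] -/
private theorem disp_self (c : ℝ) (x : Site P j) (μ : Fin P.d) : disp c x x μ = 0 := by
  simp [disp, steps]

/-- For a picture with its NATURAL localization no leg is moved and the first-order Taylor reading vanishes (the expansion
(3.10) is around the localization vertex). [cite: Balaban1983Higgs3, (3.10) p.435] -/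
theorem ampT1_natural (G : Graph nbar) (e e' : Leg G.kind) (η : ℝ) (K : (Fin G.nV → Site P j) → W →ₗ[ℝ] W)
    (φ φ' : SiteField P j W) : ampT1 (LocPicture.natural G) e e' η K φ φ' = 0 := by
  unfold ampT1 LocPicture.natural
  simp [disp_self]

/-! ### The dot -/

/-- **"the coefficient in the vertex, i.e. the expression in the square brackets in (3.15)"**: for the kernel `Σ₃₉[G₀, G]` READ
OFF THE LINES of (3.6)₁ (this lineage's `sigma39`: the doubly differentiated φ′-line ↦ Σ_ν(∂^η_νG₀∂^{η*}_ν)(x,x′), the A′-line ↦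
G(x,x′), vertex factors q g(x), q g′(x′)) the vertex coefficient IS r15's square bracket `bracket315 η G₀ G g g′ (x′_μ − x_μ)` times
`q²`. [cite: Balaban1983Higgs3, (3.15) p.437] -/
theorem vertexCoeff315_sigma39 (η : ℝ) (q : W →ₗ[ℝ] W) (G0 G : Kernel P j) (g g' : SiteField P j ℝ) (μ : Fin P.d)
    (x : Site P j) :
    vertexCoeff315 η (sigma39 η q G0 G g g') μ x =
      bracket315 η G0 G g g' (fun μ x x' => disp η⁻¹ x x' μ) μ x • (q ∘ₗ q) := by
  unfold vertexCoeff315 sigma39 bracket315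
  simp only [smul_smul, ← Finset.sum_smul]
  congr 1
  exact Finset.sum_congr rfl fun x' _ => by ring

/-- **«—•→—» ↦ (3.15)**: the expression of the dot with that coefficient IS r15's (3.15) `expr315 η q G₀ G …` up to print's exterior
sign ((3.15) opens with "−Σ_μΣ_x …"). [cite: Balaban1983Higgs3, (3.15) p.437] -/
theorem amp315_sigma39 (η : ℝ) (q : W →ₗ[ℝ] W) (G0 G : Kernel P j) (g g' : SiteField P j ℝ) (φ φ' : SiteField P j W) :
    amp315 η (vertexCoeff315 η (sigma39 η q G0 G g g')) φ φ' =
      -expr315 η q G0 G g g' (fun μ x x' => disp η⁻¹ x x' μ) φ (fun μ => pdiff η⁻¹ μ φ') := by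
  unfold amp315 expr315
  simp only [vertexCoeff315_sigma39, LinearMap.smul_apply, LinearMap.coe_comp, Function.comp_apply, real_inner_smul_right,
    neg_neg]

variable (hn : 1 ≤ nbar)

/-- The first-order Taylor reading of the COUNTERTERM picture (3.7)₁ (both external legs at x; the leg of φ′ moved from x′):
`Σ_{x,x′} η^{2d} Σ_μ (x′_μ − x_μ) ⟪φ(x), Σ(x,x′)(∂^η_μφ′)(x)⟫` — the first expression of (3.11) without its sign, before the bracket is
collected. [cite: Balaban1983Higgs3, (3.11) p.436] -/
theorem ampT1_pic37a (η : ℝ) (Sg : Site P j → Site P j → W →ₗ[ℝ] W) (φ φ' : SiteField P j W) :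
    ampT1 (pic37a hn) (sLeg 0 1) (sLeg 1 1) η (kernel2 Sg) φ φ' =
      ∑ x : Site P j, ∑ x' : Site P j, η ^ (2 * P.d) *
        ∑ μ : Fin P.d, disp η⁻¹ x x' μ * ⟪φ x, Sg x x' (pdiff η⁻¹ μ φ' x)⟫ := by
  unfold ampT1
  rw [pic37a_loc, pic37a_loc, loc37_ext.1, loc37_ext.2]
  show ∑ xs : Fin 2 → Site P j, η ^ (2 * P.d) *
      ∑ μ : Fin P.d, disp η⁻¹ (xs 0) (xs 1) μ * ⟪φ (xs 0), kernel2 Sg xs (pdiff η⁻¹ μ φ' (xs 0))⟫ = _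
  rw [sum_arrow_fin_two]
  rfl

/-- **THE COLLAPSE TO THE DOT — "this expression is represented graphically by —•→—"**: the p. 417-localized (3.6)₁ (both external
legs at x, summation over x′) with the first-order Taylor decoration of the moved leg IS the dot with *"the coefficient in the
vertex"* `c_μ(x) = Σ_{x′}η^d(x′_μ − x_μ)Σ(x,x′)`. [cite: Balaban1983Higgs3, (3.15) p.437] -/
theorem ampT1_pic37a_eq_amp315 (η : ℝ) (Sg : Site P j → Site P j → W →ₗ[ℝ] W) (φ φ' : SiteField P j W) :
    ampT1 (pic37a hn) (sLeg 0 1) (sLeg 1 1) η (kernel2 Sg) φ φ' = amp315 η (vertexCoeff315 η Sg) φ φ' := by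
  rw [ampT1_pic37a]
  unfold amp315 vertexCoeff315
  simp only [LinearMap.sum_apply, LinearMap.smul_apply, inner_sum, real_inner_smul_right, Finset.mul_sum]
  calc ∑ x : Site P j, ∑ x' : Site P j, ∑ μ : Fin P.d,
          η ^ (2 * P.d) * (disp η⁻¹ x x' μ * ⟪φ x, Sg x x' (pdiff η⁻¹ μ φ' x)⟫)
      = ∑ x : Site P j, ∑ μ : Fin P.d, ∑ x' : Site P j,
          η ^ (2 * P.d) * (disp η⁻¹ x x' μ * ⟪φ x, Sg x x' (pdiff η⁻¹ μ φ' x)⟫) :=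
        Finset.sum_congr rfl fun _ _ => Finset.sum_comm
    _ = ∑ μ : Fin P.d, ∑ x : Site P j, ∑ x' : Site P j,
          η ^ (2 * P.d) * (disp η⁻¹ x x' μ * ⟪φ x, Sg x x' (pdiff η⁻¹ μ φ' x)⟫) := Finset.sum_comm
    _ = ∑ μ : Fin P.d, ∑ x : Site P j, ∑ x' : Site P j,
          η ^ P.d * (η ^ P.d * disp η⁻¹ x x' μ * ⟪φ x, Sg x x' (pdiff η⁻¹ μ φ' x)⟫) := by
        refine Finset.sum_congr rfl fun μ _ => Finset.sum_congr rfl fun x _ => Finset.sum_congr rfl fun x' _ => ?_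
        rw [two_mul, pow_add]
        ring

/-! ### The generalized graph (3.12) -/

/-- The expression of (3.12) with a two-point kernel `Σ(x,x′)` on its lines: `Σ_{x,x′} η^{2d} ⟪φ(x), Σ(x,x′) R(x,x′)⟫` with the (3.10)
remainder `R(x,x′) = remFwd η⁻¹ φ′ x x′` of the leg φ′ (base x, leg at x′). [cite: Balaban1983Higgs3, (3.12) p.436] -/
theorem ampR_dec312_kernel2 (α η : ℝ) (Sg : Site P j → Site P j → W →ₗ[ℝ] W) (φ φ' : SiteField P j W) :
    ampR (dec312 hn α) (sLeg 0 1) η (kernel2 Sg) φ φ' =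
      ∑ x : Site P j, ∑ x' : Site P j, η ^ (2 * P.d) * ⟪φ x, Sg x x' (remFwd η⁻¹ φ' x x')⟫ := by
  unfold ampR
  show ∑ xs : Fin 2 → Site P j, η ^ (2 * P.d) * ⟪φ (xs 0), kernel2 Sg xs (remFwd η⁻¹ φ' (xs 0) (xs 1))⟫ = _
  rw [sum_arrow_fin_two]
  rfl

/-- **(3.12)-picture ↦ p20's (3.12)**: with the kernel `Σ₃₉[G_{(j)}(0), G_{(j′)}]` of the lines of (3.6)₁ the decorated picture reads as
`B3Ineq313Pointwise.term312 η q G_{(j)}(0) G_{(j′)} g g′ φ φ′` — the second term of (3.11), the generalized expression of degree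
−d + 3 + α, for every drawn exponent. [cite: Balaban1983Higgs3, (3.12) p.436] -/
theorem ampR_dec312 (α η : ℝ) (q : W →ₗ[ℝ] W) (Gj Gj' : Kernel P j) (g g' : SiteField P j ℝ) (φ φ' : SiteField P j W) :
    ampR (dec312 hn α) (sLeg 0 1) η (kernel2 (sigma39 η q Gj Gj' g g')) φ φ' = term312 η q Gj Gj' g g' φ φ' := by
  rw [ampR_dec312_kernel2]
  unfold term312 sigma39
  refine Finset.sum_congr rfl fun x _ => Finset.sum_congr rfl fun x' _ => ?_
  simp only [LinearMap.smul_apply, LinearMap.coe_comp, Function.comp_apply, real_inner_smul_right]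

/-! ### (3.17) -/

/-- **(3.17) PER PAIR OF LINE PROPAGATORS** (before the summation over orderings; η ≠ 0, every drawn exponent): the expression of the
left side (3.8) with the kernel `Σ₃₉[G_j, G_j′]` read off its lines EQUALS the dot with the coefficient `vertexCoeff315 Σ₃₉` plus the
decorated picture (3.12) — r15's/p20's (3.11) `eq311_split` through p26 g33's `expr39_eq_neg_amp_pic38` and the dictionary above.
[cite: Balaban1983Higgs3, (3.11) p.436, (3.17) p.437] -/
theorem eq317_pair (η : ℝ) (hη : η ≠ 0) (α : ℝ) (q : W →ₗ[ℝ] W) (Gj Gj' : Kernel P j) (g g' : SiteField P j ℝ)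
    (φ φ' : SiteField P j W) :
    (pic38 hn).amp (sLeg 0 1) (sLeg 1 1) (sLeg 0 1) (sLeg 1 1) η
        (kernel2 (sigma39 η q Gj Gj' g g')) (kernel2 (sigma39 η q Gj Gj' g g')) φ φ' =
      amp315 η (vertexCoeff315 η (sigma39 η q Gj Gj' g g')) φ φ' +
        ampR (dec312 hn α) (sLeg 0 1) η (kernel2 (sigma39 η q Gj Gj' g g')) φ φ' := by
  have h1 : (pic38 hn).amp (sLeg 0 1) (sLeg 1 1) (sLeg 0 1) (sLeg 1 1) η
      (kernel2 (sigma39 η q Gj Gj' g g')) (kernel2 (sigma39 η q Gj Gj' g g')) φ φ' = -expr39 η q Gj Gj' g g' φ φ' := by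
    rw [expr39_eq_neg_amp_pic38 hn, neg_neg]
  rw [h1, amp315_sigma39, ampR_dec312, eq311_split η hη q Gj Gj' g g' φ φ', expr315_eq]
  ring

/-- **(3.17)** p. 437 [PDF 27] — *"Making summations over these orderings and indices means that we sum with respect to j, j′ from 0 to
j″ … After the summations we get (3.15) … Thus we have finished the analysis of (3.8) and we can summarize it in the following
graphical form [(3.6)₁ − (3.7)₁] = [—•→—] + [(3.12)] (3.17)"*: for any families of line propagators `G0fam` (the φ′-line,
`G_{(i)}(0)`) and `Gfam` (the A′-line, `G_{(i′)}`) and η ≠ 0, the expressions of the left side summed over the line indices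
`i, i′ < k` EQUAL the dot whose coefficient is built on the RESUMMED propagators `Σ_iG0fam i`, `Σ_{i′}Gfam i′` plus the sum of the
decorated pictures — p20 g6's `B3Eq317ZeroTorus.sum_expr39_eq` BY NAME through the dictionary.  LATTICE FORM of (3.17) (the print's
§3 carrier ηℤ³, zero field): p39 g17's `B3Eq317ZeroLattice.eq317_zeroLattice` (at the top index j″ = k) and
`B3GscaleLatRescaling.eq317_zeroLattice_allScales` (every j″ ≤ k), assembled from p26 g34's `B3Ineq313Lattice.eq311Z`/`term312Z` and
`B3Ineq314ZeroLattice.eq315Z_zeroLattice` — the same identity with finite localization sets in place of the torus sums; the drawn objects and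
count data above are carrier-free. [cite: Balaban1983Higgs3, (3.17) p.437] -/
theorem eq317 (η : ℝ) (hη : η ≠ 0) (α : ℝ) (q : W →ₗ[ℝ] W) (k : ℕ) (G0fam Gfam : ℕ → Kernel P j)
    (g g' : SiteField P j ℝ) (φ φ' : SiteField P j W) :
    ∑ i ∈ range k, ∑ i' ∈ range k,
        (pic38 hn).amp (sLeg 0 1) (sLeg 1 1) (sLeg 0 1) (sLeg 1 1) η
          (kernel2 (sigma39 η q (G0fam i) (Gfam i') g g')) (kernel2 (sigma39 η q (G0fam i) (Gfam i') g g')) φ φ' =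
      amp315 η (vertexCoeff315 η (sigma39 η q (∑ i ∈ range k, G0fam i) (∑ i' ∈ range k, Gfam i') g g')) φ φ' +
        ∑ i ∈ range k, ∑ i' ∈ range k,
          ampR (dec312 hn α) (sLeg 0 1) η (kernel2 (sigma39 η q (G0fam i) (Gfam i') g g')) φ φ' := by
  have h1 : ∀ i i' : ℕ, (pic38 hn).amp (sLeg 0 1) (sLeg 1 1) (sLeg 0 1) (sLeg 1 1) η
      (kernel2 (sigma39 η q (G0fam i) (Gfam i') g g')) (kernel2 (sigma39 η q (G0fam i) (Gfam i') g g')) φ φ' =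
        -expr39 η q (G0fam i) (Gfam i') g g' φ φ' := by
    intro i i'
    rw [expr39_eq_neg_amp_pic38 hn, neg_neg]
  simp_rw [h1, ampR_dec312, amp315_sigma39, Finset.sum_neg_distrib]
  rw [sum_expr39_eq η hη q k G0fam Gfam g g' φ φ']
  ring

end

end Dictionary

/-! ## §4 (3.17) "of the required form (3.5)" at the zero-field torus instance, hypothesis-free -/

section ZeroTorus

universe u

open B3Prop1 B3Cor23Concrete B3Sect3LowestOrderGraphs B3Eq37Pictures B3Eq332Pictures
open LatticeFieldCalculus (pdiff)
open B3Sect3ScalarSelfEnergy B3Eq330Members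
open B3Taylor310Remainder (disp remFwd HolderDeriv)
open B3Ineq313Pointwise (term312)
open B3Sect3KernelsZeroTorus (gpiece)
open B3Eq317ZeroTorus (eq317_zero_torus)

variable {nbar : ℕ} (hn : 1 ≤ nbar)

/-- **(3.17) AT THE ZERO-FIELD TORUS MODEL INSTANCE, d = 3, through the dictionary** (p20 g6's `eq317_zero_torus`): for odd `L > 1`,
`a > 0`, `m² ≥ 0` there are `δ, C, Cst > 0` such that for EVERY volume of Bałaban's scalar torus tower, every `1 ≤ k ≤ K` (`k = j″`),
every charge matrix `‖qw‖ ≤ Q‖w‖`, localizations `|g|, |g′| ≤ 1`, every field φ and every Hölder-α leg φ′ (`0 ≤ α ≤ 1`), with the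
lines of the pictures carrying the tower's pieces `gpiece`:
(a) [(3.6)₁ − (3.7)₁] summed over the line indices = [—•→— on the resummed propagator] + Σ [(3.12)] (`eq317`);
(b) the dot is *"a vertex"* with a BOUNDED coefficient: |amp315| ≤ Cst·Σ_μΣ_x η³‖φ(x)‖‖q²(∂^η_μφ′)(x)‖ ((3.16) *"by a constant"*);
(c) every decorated piece obeys the generalized-graph estimate (3.13) with the factors (L^iη)^{−d}e^{−½δ|x−x′|/L^iη}(L^{i′}η)^{−d+2}
e^{…}(L^{i₁}η)^{1+α}, i₁ = min(i,i′) (degree −d + 3 + α) — *"It is of the required form (3.5)."*  The LATTICE form of the same three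
clauses on the print's carrier ηℤ³ (G_k(0) = G_k(ηℤ³, 0), p. 433) is p39 g17's `B3Eq317ZeroLattice.eq317_zeroLattice` (p348524) /
`B3GscaleLatRescaling.eq317_zeroLattice_allScales` (p349406); this torus instance is p20 g6's `eq317_zero_torus` read through the dictionary.
[cite: Balaban1983Higgs3, (3.17) p.437] -/
theorem eq317_pic_zeroTorus (L : ℕ) (hL : Odd L ∧ 1 < L) {a : ℝ} (ha : 0 < a) {msq : ℝ} (hmsq : 0 ≤ msq) :
    ∃ δ C Cst : ℝ, 0 < δ ∧ 0 < C ∧ 0 < Cst ∧ ∀ (P : Params), P.d = 3 → P.L = L → ∀ k : ℕ, 1 ≤ k → k ≤ P.K →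
      ∀ {W : Type u} [NormedAddCommGroup W] [InnerProductSpace ℝ W] {α H Q : ℝ}, 0 ≤ α → α ≤ 1 → 0 ≤ H → 0 ≤ Q →
        ∀ (q : W →ₗ[ℝ] W), (∀ w : W, ‖q w‖ ≤ Q * ‖w‖) →
        ∀ (g g' : SiteField P 0 ℝ), (∀ x, |g x| ≤ 1) → (∀ x, |g' x| ≤ 1) →
        ∀ (φ φ' : SiteField P 0 W), HolderDeriv (P.eps)⁻¹ α H φ' →
          (∑ i ∈ range k, ∑ i' ∈ range k,
              (pic38 hn).amp (sLeg 0 1) (sLeg 1 1) (sLeg 0 1) (sLeg 1 1) P.eps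
                (kernel2 (sigma39 P.eps q (gpiece P a msq k i) (gpiece P a msq k i') g g'))
                (kernel2 (sigma39 P.eps q (gpiece P a msq k i) (gpiece P a msq k i') g g')) φ φ' =
            amp315 P.eps (vertexCoeff315 P.eps (sigma39 P.eps q (∑ i ∈ range k, gpiece P a msq k i)
                (∑ i ∈ range k, gpiece P a msq k i) g g')) φ φ' +
              ∑ i ∈ range k, ∑ i' ∈ range k, ampR (dec312 hn α) (sLeg 0 1) P.eps
                (kernel2 (sigma39 P.eps q (gpiece P a msq k i) (gpiece P a msq k i') g g')) φ φ') ∧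
          |amp315 P.eps (vertexCoeff315 P.eps (sigma39 P.eps q (∑ i ∈ range k, gpiece P a msq k i)
              (∑ i ∈ range k, gpiece P a msq k i) g g')) φ φ'| ≤
            Cst * ∑ μ : Fin P.d, ∑ x : Site P 0, P.eps ^ P.d * (‖φ x‖ * ‖q (q (pdiff P.eps⁻¹ μ φ' x))‖) ∧
          ∀ i i' : ℕ,
            |ampR (dec312 hn α) (sLeg 0 1) P.eps
                (kernel2 (sigma39 P.eps q (gpiece P a msq k i) (gpiece P a msq k i') g g')) φ φ'| ≤
              2 * P.d * C * C * Q ^ 2 * H * (2 / δ + 8 / δ ^ 2) *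
                (min (P.spacing i) (P.spacing i') * (min (P.spacing i) (P.spacing i')) ^ α) *
                ∑ x : Site P 0, ∑ x' : Site P 0, P.eps ^ (2 * P.d) *
                  (‖φ x‖ * (P.spacing i ^ (-(P.d : ℝ)) *
                      Real.exp (-(δ / 2 * (P.spacing i)⁻¹ * (P.eps * Site.tdist x x'))))
                    * (P.spacing i' ^ ((2 : ℝ) - (P.d : ℝ)) *
                      Real.exp (-(δ / 2 * (P.spacing i')⁻¹ * (P.eps * Site.tdist x x'))))) := by
  obtain ⟨δ, C, Cst, hδ, hC, hCst, H⟩ := eq317_zero_torus.{u} L hL ha hmsq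
  refine ⟨δ, C, Cst, hδ, hC, hCst, ?_⟩
  intro P hPd hPL k hk1 hkK W _ _ α Hc Q hα0 hα1 hH hQ q hq g g' hg hg' φ φ' hφ'
  obtain ⟨-, hb, hc⟩ := H P hPd hPL k hk1 hkK hα0 hα1 hH hQ q hq g g' hg hg' φ φ' hφ'
  refine ⟨eq317 hn P.eps P.eps_pos.ne' α q k _ _ g g' φ φ', ?_, fun i i' => ?_⟩
  · rw [amp315_sigma39, abs_neg]
    exact hb
  · rw [ampR_dec312]
    exact hc i i'

end ZeroTorus

end Literature.MathematicalPhysics.QuantumFieldTheory.Balaban1983to89.B3Eq317Pictures
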